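import Literature.NumberTheory.DiophantineGeometry.MultiplicativeGroupApproximationThm328Proofs
import Literature.Barriers.ABC.BakerMethodBoundsYuInput
import HarnessLib

/-!
# Matveev's theorem on linear forms in logarithms over `ℚ` (Evertse–Győry, Thm. 3.2.4; named
# fact), and Evertse–Győry Thm. 4.2.1 over `ℚ` assembled from Matveev and Yu

Topic `NumberTheory/DiophantineGeometry`; namespace
`Literature.NumberTheory.DiophantineGeometry.Dioph`. Fact-decomposition record for the named fact
`evertseGyory_thm_4_2_1_rat` (`MultiplicativeGroupApproximation.lean`: Evertse–Győry, *Unit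
Equations in Diophantine Number Theory* (2015), Thm. 4.2.1 for `K = ℚ` — the effective
approximation bound `log |1 − αξ|_v > −C₈(m) Θ H max{log(2B/H), 1}` on finitely generated
multiplicative groups), which hit the literature-prover budget cap.

State of the printed proof in the tree. §4.3–§4.4 of the book (Minkowski's second theorem,
Borosh–Flahive–Rubin–Treybig, Prop. 4.3.4, Prop. 4.4.1, Cases A/B, Liouville) are PROVED
(`…Proofs`, `…LatticeProofs`, `…MinkowskiProofs`, `…Prop434Proofs`, `…Prop441Proofs`,
`…ReductionProofs`, `…CaseBProofs`), as is the derivation of Thm. 3.2.8 over `ℚ` from its two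
external inputs (p. 63; `…Thm328Proofs`): `evertseGyory_thm_4_2_1_rat_of_matveev_yu` proves the
fact from the binders `hM` (Thm. 3.2.4 = Matveev 2000, Cor. 2.3, `K = ℚ`) and `hY` (Thm. 3.2.7 =
Yu 2007, `K = ℚ`). The second is already a named fact of the tree,
`Literature.Barriers.ABC.yu2007_padicLogForm_rat` (filed 2026-08-16 with the Stewart–Tijdeman
decomposition; slated to move to this directory by a later refactor — hence the cross-topic import,
the only way to reuse it without restating it). This file NAMES the first,
`matveev2000_linearFormsLog_rat` (the binder `hM` verbatim, printed constant
`C₁(n, 1) = min{(en/2) 30^{n+3} n^{3.5}, 2^{6n+20}}`), and PROVES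
`evertseGyory_thm_4_2_1_rat_holds_of : matveev2000_linearFormsLog_rat →
yu2007_padicLogForm_rat → evertseGyory_thm_4_2_1_rat`. Neither antecedent restates the parent:
they are the archimedean and the `p`-adic lower bounds for linear forms in logarithms, the parent
is the approximation theorem on multiplicative groups derived from them by the geometry of numbers.

## References

* [EvertseGyory2015] J.-H. Evertse, K. Győry, Unit Equations in Diophantine Number Theory, CUP
  2015: Thm. 3.2.4 (p. 61), Thm. 3.2.7 (p. 62), Thm. 3.2.8 (pp. 62–63), Thm. 4.2.1 (p. 68), §4.4.
* [Matveev2000] E. M. Matveev, An explicit lower bound for a homogeneous rational linear form in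
  logarithms of algebraic numbers II, Izv. Math. 64 (2000) 1217–1269, Cor. 2.3.
* [Yu2007] K. Yu, `p`-adic logarithmic forms and group varieties III, Forum Math. 19 (2007).
-/

open Height Real Finset

noncomputable section

namespace Literature.NumberTheory.DiophantineGeometry.Dioph

/-- NAMED FACT — **Matveev's lower bound for linear forms in logarithms, case `K = ℚ`**
(Evertse–Győry 2015, Thm. 3.2.4 = Matveev 2000, Cor. 2.3; `d = 1`, `K ⊂ ℝ` so `χ = 1`,
`d² log(ed) = 1`). For positive rationals `a₁, …, aₙ ≠ 1` (`n ≥ 2`, indexed by a finite type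
`κ`) with real logarithms `log aₖ`, integers `b₁, …, bₙ` not all zero with
`Σ = b₁ log a₁ + ⋯ + bₙ log aₙ ≠ 0`, reals `Aₖ ≥ max{h(aₖ), |log aₖ|, 0.16}` (`logHeight₁`) and
`B ≥ max{1, maxₖ |bₖ| Aₖ / A_{k₀}}` for a distinguished index `k₀`:
`log |Σ| > −C₁(n, 1) A₁ ⋯ Aₙ log(eB)` with `C₁(n, 1) = min{(en/2) 30^{n+3} n^{3.5}, 2^{6n+20}}`.
This is the binder `hM` of `thm328_rat_infinite_of_matveev` and
`evertseGyory_thm_4_2_1_rat_of_matveev_yu` verbatim. Users take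
`(h : matveev2000_linearFormsLog_rat)`. [cite: EvertseGyory2015, Thm 3.2.4 (p. 61)] -/
def matveev2000_linearFormsLog_rat : Prop :=
  ∀ (κ : Type) [Fintype κ], 2 ≤ Fintype.card κ →
    ∀ (a : κ → ℚ) (b : κ → ℤ) (A : κ → ℝ) (k₀ : κ) (B : ℝ),
      (∀ k, 0 < a k ∧ a k ≠ 1) → b ≠ 0 →
      ∑ k, (b k : ℝ) * Real.log (a k : ℝ) ≠ 0 →
      (∀ k, max (logHeight₁ (a k)) (max |Real.log (a k : ℝ)| 0.16) ≤ A k) →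
      1 ≤ B → (∀ k, (|b k| : ℝ) * A k / A k₀ ≤ B) →
      -(min (Real.exp 1 * Fintype.card κ / 2 * 30 ^ (Fintype.card κ + 3) *
              (Fintype.card κ : ℝ) ^ (7 / 2 : ℝ))
            (2 ^ (6 * Fintype.card κ + 20)) *
          (∏ k, A k) * Real.log (Real.exp 1 * B)) <
        Real.log |∑ k, (b k : ℝ) * Real.log (a k : ℝ)|

/-- **Assembly (fact-decompose): Evertse–Győry Thm. 4.2.1 over `ℚ` from Matveev and Yu over
`ℚ`.** `matveev2000_linearFormsLog_rat → yu2007_padicLogForm_rat → evertseGyory_thm_4_2_1_rat`,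
by `evertseGyory_thm_4_2_1_rat_of_matveev_yu` (Thm. 3.2.8 over `ℚ` from the two, p. 63; then
§4.4, pp. 80–81 — all proved in the tree).
[cite: EvertseGyory2015, Thm 3.2.4 (p. 61), Thm 3.2.7 (p. 62), Thm 4.2.1 (p. 68)] -/
theorem evertseGyory_thm_4_2_1_rat_holds_of (hM : matveev2000_linearFormsLog_rat)
    (hY : Literature.Barriers.ABC.yu2007_padicLogForm_rat) : evertseGyory_thm_4_2_1_rat :=
  evertseGyory_thm_4_2_1_rat_of_matveev_yu hM hY

end Literature.NumberTheory.DiophantineGeometry.Dioph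

end
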